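import Summits.BirchSwinnertonDyer.BirchSwinnertonDyer.Theorems.EisensteinPrimesMazurMCOnCellBTwistbackTwistDoorIsogenous
import Summits.BirchSwinnertonDyer.BirchSwinnertonDyer.Theorems.EisensteinPrimesMazurMCOnCellBTwistbackKLFlatPartnerUnits
import Summits.BirchSwinnertonDyer.BirchSwinnertonDyer.Theorems.EisensteinPrimesMazurMCOnCellBTwistbackPartnerClassNumberLift
import HarnessLib

/-!
# Crux 3 `MazurMCOnCellB` (stmt-BirchSwinnertonDyer-19033), line `twistback` v4 — the TWIST DOOR FROM THE
# `W`-SIDE, part 3: the CLASS-NUMBER form — the two KL-flat units of the twisted characters from the Weil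
# relation of `W`'s characters, `ψ(p) ≠ 1` (resp. `φ(p) ≠ 1`) and ONE class number `p ∤ h(d·d_K)` (resp. `h(m·d_K)`)

Width seat bsd-line-x2-p1-w3 (gen 9), cell `bsd-eis` (run/shared/lean/pub/bsd-eis/), 2026-08-28. HONEST FRAMING:
THEOREMS ONLY (no `def`, no named fact introduced, no `sorry`); Dirichlet-character algebra + composition of LEAD g10's
p645771 §1 (`klFlat_of_norm_twistedBernoulli_eq_one`) and width seat w3 g7's p645724
(`norm_twistedBernoulli_teichmullerLift_inv_eq_one_iff_of_isPrimitive`) AT THE TWISTED CHARACTERS with parts 1–2 of this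
door; `--supports` stmt-BirchSwinnertonDyer-19033; closes no stub by itself; no summit statement, no Mazur main conjecture
and no BSD is proved for any curve; 0 cells / labels / tiers move.

* §1 curve-free lemmas on the twisted characters `θχ̄` (`χ` the Jacobi character mod `|D|`, `D ≡ 1 (mod 4)`, `D < 0`):
  `jacobiChar_neg_one` (`χ(−1) = −1`: `|D| ≡ 3 (mod 4)`); `isQuadratic_twistChar` (quadratic-valued);
  `odd_twistChar_of_even` (`θ` even ⟹ `θχ̄` odd); `weil_twistChar` (the Weil relation `φ(a)a⁻¹ = ψ⁻¹(a)` passes to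
  `(φχ̄, ψχ̄)`: `χ̄² = 1`); `weil_symm` (`φ(a)a⁻¹ = ψ⁻¹(a) ⟹ ψ(a)a⁻¹ = φ⁻¹(a)`).
* §2 `klFlat_twistChar_of_not_dvd_classNumber` — the TWO units `‖L_∅(C,0)(φχ̄)‖ = ‖L_∅(D,0)(ψχ̄)‖ = 1` from: the Weil
  relation of `(φ, ψ)`, `ψ` primitive even quadratic-valued mod `d` coprime to `D`, `ψ(p) ≠ 1`, `χ(p) = 1`, `D < −4`, and
  ONE class number `p ∤ h(d·D)` (`ψχ̄` is odd, primitive, quadratic-valued mod `d|D| > 4`).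
* §3 `klFlatCarrier_twist_of_lineRamifiedOdd_of_classNumber` / `klFlatCarrier_twist_of_lineUnramifiedEven_of_classNumber`
  — parts 1–2's doors with the two units REPLACED by (Weil relation, `ψ(p) ≠ 1` resp. `φ(p) ≠ 1`, parity and
  quadratic-valuedness of the quotient resp. line character, `d_K < −4`, ONE class number `p ∤ h(d·d_K)` resp.
  `p ∤ h(m·d_K)`): the carrier clause `hKL` of p645525 §3 (= the body of w5's `hDict`, p652304) per `(W, K, Wd)`.
  The Weil relation is a hypothesis here (GV p. 28 `φψ = ω`; width seat w7 derives it); `ψ(p) ≠ 1` is «non-split»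
  (w7 p649032 / p650111).

References: [GreenbergVatsal2000] §2 p. 28 (φψ = ω), §3 (26)–(28); [Washington1997] Thm. 4.17, Thm. 5.11;
[LangCyclotomic1990] Ch. 4 §3 Thm. 3.2; [Cox2013] §1.C Lemma 1.14, Thm. 7.7 (ii); [MontgomeryVaughan2007] §9.3 Thm. 9.13.
-/

set_option autoImplicit false

-- `Summit.BirchSwinnertonDyer.BirchSwinnertonDyer.…`: the summit and its single sub-problem share a name.
set_option linter.dupNamespace false

noncomputable section

open scoped Classical NumberTheorySymbols

open WeierstrassCurve NumberField IsDedekindDomain Field DirichletCharacter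
  Literature.NumberTheory.EllipticCurves Literature.NumberTheory.GaloisRepresentations
  Literature.NumberTheory.EllipticCurves.GreenbergVatsal2000
  Literature.NumberTheory.EllipticCurves.Rank1Residual
  Literature.NumberTheory.QuadraticFields Literature.NumberTheory.QuadraticFields.Quadratic
  Summit.BirchSwinnertonDyer.Rank1Residual Summit.BirchSwinnertonDyer.Rank1Residual.X2
  Summit.BirchSwinnertonDyer.BirchSwinnertonDyer.Theorems.EisensteinPrimesMazurMCOnCellBTwistbackTwistLineCharacters
  Summit.BirchSwinnertonDyer.BirchSwinnertonDyer.Theorems.EisensteinPrimesMazurMCOnCellBTwistbackQuadraticRadical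
  Summit.BirchSwinnertonDyer.BirchSwinnertonDyer.Theorems.EisensteinPrimesMazurMCOnCellBTwistbackTwistLocalBalance
  Summit.BirchSwinnertonDyer.BirchSwinnertonDyer.Theorems.EisensteinPrimesMazurMCOnCellBTwistbackKLFlatPartnerUnits
  Summit.BirchSwinnertonDyer.BirchSwinnertonDyer.Theorems.EisensteinPrimesMazurMCOnCellBTwistbackPartnerClassNumberLift
  Summit.BirchSwinnertonDyer.BirchSwinnertonDyer.Theorems.EisensteinPrimesMazurMCOnCellBTwistbackTwistDoor
  Summit.BirchSwinnertonDyer.BirchSwinnertonDyer.Theorems.EisensteinPrimesMazurMCOnCellBTwistbackTwistDoorIsogenous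

namespace Summit.BirchSwinnertonDyer.BirchSwinnertonDyer.Theorems.EisensteinPrimesMazurMCOnCellBTwistbackTwistDoorClassNumber

/-! ## §1. Curve-free lemmas on the twisted characters -/

/-- **`χ(−1) = −1` for the Jacobi character of an odd NEGATIVE fundamental discriminant** (`D ≡ 1 (mod 4)`, `D < 0`, so
`|D| ≡ 3 (mod 4)` and `(−1/|D|) = −1`): the character of an imaginary quadratic field is odd.
[cite: Cox2013, §1.C Lemma 1.14] -/
theorem jacobiChar_neg_one {D : ℤ} (hD4 : D % 4 = 1) (hD : D < 0) [NeZero D.natAbs]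
    (χ : MulChar (ZMod D.natAbs) ℤ) (hχJ : ∀ a : ℕ, χ (a : ZMod D.natAbs) = J((a : ℤ) | D.natAbs)) :
    χ (-1) = -1 := by
  have hN1 : 1 ≤ D.natAbs := Nat.one_le_iff_ne_zero.mpr (NeZero.ne _)
  have hcast : ((D.natAbs - 1 : ℕ) : ZMod D.natAbs) = -1 := by
    rw [Nat.cast_sub hN1, Nat.cast_one, ZMod.natCast_self, zero_sub]
  have hmod : ((D.natAbs : ℤ) - 1) % (D.natAbs : ℕ) = (-1) % (D.natAbs : ℕ) := by
    rw [show ((D.natAbs : ℤ) - 1) = -1 + 1 * (D.natAbs : ℤ) by ring, Int.add_mul_emod_self_right]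
  have hodd : Odd D.natAbs := Int.natAbs_odd.mpr (Int.odd_iff.mpr (by omega))
  rw [← hcast, hχJ, Nat.cast_sub hN1, Nat.cast_one, jacobiSym.mod_left' hmod, jacobiSym.at_neg_one hodd]
  exact ZMod.χ₄_nat_three_mod_four (by omega)

variable {p : ℕ} [Fact p.Prime]

/-- **The twisted character `θχ̄` is quadratic-valued** when `θ` and `χ` are. [folklore] -/
theorem isQuadratic_twistChar {d N : ℕ} [NeZero d] [NeZero N] (θ : DirichletCharacter (ZMod p) d)
    (χ : MulChar (ZMod N) ℤ) (hθq : θ.IsQuadratic) (hχ2 : χ.IsQuadratic) :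
    (changeLevel (dvd_mul_right d N) θ *
        changeLevel (dvd_mul_left N d) (χ.ringHomComp (Int.castRingHom (ZMod p))) :
      DirichletCharacter (ZMod p) (d * N)).IsQuadratic := by
  intro x
  rw [← ZMod.natCast_zmod_val x, changeLevel_mul_changeLevel_apply_natCast, ringHomComp_apply_eq_intCast]
  rcases hθq (x.val : ZMod d) with h | h | h <;> rcases hχ2 (x.val : ZMod N) with h' | h' | h' <;>
    (rw [h, h']; simp)

/-- **`θ` even and `χ(−1) = −1` ⟹ `θχ̄` odd.** [folklore] -/
theorem odd_twistChar_of_even {d N : ℕ} [NeZero d] [NeZero N] (θ : DirichletCharacter (ZMod p) d)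
    (χ : MulChar (ZMod N) ℤ) (hθe : θ.Even) (hχ : χ (-1) = -1) :
    (changeLevel (dvd_mul_right d N) θ *
        changeLevel (dvd_mul_left N d) (χ.ringHomComp (Int.castRingHom (ZMod p))) :
      DirichletCharacter (ZMod p) (d * N)).Odd := by
  have h1 : 1 ≤ d * N := Nat.one_le_iff_ne_zero.mpr (NeZero.ne _)
  have hcast : ∀ n : ℕ, n ∣ d * N → ((d * N - 1 : ℕ) : ZMod n) = -1 := by
    intro n hn
    obtain ⟨k, hk⟩ := hn
    rw [Nat.cast_sub h1, Nat.cast_one, hk, Nat.cast_mul, ZMod.natCast_self, zero_mul, zero_sub]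
  change _ = _
  rw [← hcast (d * N) dvd_rfl, changeLevel_mul_changeLevel_apply_natCast, ringHomComp_apply_eq_intCast,
    hcast d (dvd_mul_right d N), hcast N (dvd_mul_left N d), show θ (-1) = 1 from hθe, hχ]
  push_cast
  ring

/-- **The Weil relation passes to the twisted pair**: `φ(a)·a⁻¹ = ψ⁻¹(a)` for `p ∤ a` implies
`(φχ̄)(a)·a⁻¹ = (ψχ̄)⁻¹(a)` (`χ̄(a) ∈ {0, ±1}` is its own inverse). [cite: GreenbergVatsal2000, §2 p. 28 (φψ = ω)] -/
theorem weil_twistChar {m d N : ℕ} [NeZero m] [NeZero d] [NeZero N] (φ : DirichletCharacter (ZMod p) m)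
    (ψ : DirichletCharacter (ZMod p) d) (χ : MulChar (ZMod N) ℤ) (hχ2 : χ.IsQuadratic)
    (hφψ : ∀ a : ℕ, ¬ p ∣ a → φ (a : ZMod m) * (a : ZMod p)⁻¹ = ψ⁻¹ (a : ZMod d)) :
    ∀ a : ℕ, ¬ p ∣ a →
      (changeLevel (dvd_mul_right m N) φ *
          changeLevel (dvd_mul_left N m) (χ.ringHomComp (Int.castRingHom (ZMod p))) :
        DirichletCharacter (ZMod p) (m * N)) (a : ZMod (m * N)) * (a : ZMod p)⁻¹ =
      (changeLevel (dvd_mul_right d N) ψ *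
          changeLevel (dvd_mul_left N d) (χ.ringHomComp (Int.castRingHom (ZMod p))) :
        DirichletCharacter (ZMod p) (d * N))⁻¹ (a : ZMod (d * N)) := by
  intro a ha
  have hc : (((χ (a : ZMod N) : ℤ) : ZMod p))⁻¹ = ((χ (a : ZMod N) : ℤ) : ZMod p) := by
    rcases hχ2 (a : ZMod N) with h | h | h <;> simp [h]
  rw [MulChar.inv_apply_eq_inv', changeLevel_mul_changeLevel_apply_natCast,
    changeLevel_mul_changeLevel_apply_natCast, ringHomComp_apply_eq_intCast, mul_inv, hc,
    ← MulChar.inv_apply_eq_inv', ← hφψ a ha]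
  ring

/-- **The Weil relation, swapped**: `φ(a)·a⁻¹ = ψ⁻¹(a)` for `p ∤ a` implies `ψ(a)·a⁻¹ = φ⁻¹(a)`.
[cite: GreenbergVatsal2000, §2 p. 28 (φψ = ω)] -/
theorem weil_symm {m d : ℕ} [NeZero m] [NeZero d] (φ : DirichletCharacter (ZMod p) m)
    (ψ : DirichletCharacter (ZMod p) d)
    (hφψ : ∀ a : ℕ, ¬ p ∣ a → φ (a : ZMod m) * (a : ZMod p)⁻¹ = ψ⁻¹ (a : ZMod d)) :
    ∀ a : ℕ, ¬ p ∣ a → ψ (a : ZMod d) * (a : ZMod p)⁻¹ = φ⁻¹ (a : ZMod m) := by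
  intro a ha
  have ha0 : (a : ZMod p) ≠ 0 := by rwa [Ne, ZMod.natCast_eq_zero_iff]
  have h := hφψ a ha
  rw [MulChar.inv_apply_eq_inv'] at h ⊢
  have hφ : φ (a : ZMod m) = (ψ (a : ZMod d))⁻¹ * (a : ZMod p) := by
    rw [← h, mul_assoc, inv_mul_cancel₀ ha0, mul_one]
  rw [hφ, mul_inv, inv_inv]

/-! ## §2. The two units of the twisted characters from ONE class number -/

/-- **The two KL-flat units of `(φχ̄, ψχ̄)` from ONE class number.** Data: `p` odd; `D ≡ 1 (mod 4)`, `D < −4`; `χ` the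
Jacobi character mod `|D|` (quadratic, `χ̄` primitive, `χ(a) = (a/|D|)`), `χ(p) = 1` (`p` splits in `ℚ(√D)`);
`φ` mod `m`, `ψ` mod `d` with `ψ` primitive, EVEN, quadratic-valued, `gcd(d, D) = 1`, the Weil relation
`φ(a)a⁻¹ = ψ⁻¹(a)` (`p ∤ a`) and `ψ(p) ≠ 1`; and `p ∤ h(d·D)` (form class number). Then
`‖L_∅(C,0)(φχ̄)‖ = ‖L_∅(D,0)(ψχ̄)‖ = 1`: `ψχ̄` is odd, primitive, quadratic-valued mod `d|D| > 4` with
`(ψχ̄)(p) = ψ(p) ≠ 1`, so p645724 turns the class number into the unit `‖B₁^{(d|D|)}(ω̃∘(ψχ̄)⁻¹)‖_p = 1` and p645771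
§1 (Weil relation transported by §1) gives both units. [cite: GreenbergVatsal2000, §2 p. 28, §3 (26)–(27)]
[cite: Washington1997, Thm. 4.17 and Thm. 5.11] [cite: Cox2013, Thm. 7.7 (ii)] -/
theorem klFlat_twistChar_of_not_dvd_classNumber (hp2 : p ≠ 2) {D : ℤ} (hD4 : D % 4 = 1) (hDlt : D < -4)
    [NeZero D.natAbs] (χ : MulChar (ZMod D.natAbs) ℤ) (hχ2 : χ.IsQuadratic)
    (hχp : DirichletCharacter.IsPrimitive
      (χ.ringHomComp (Int.castRingHom (ZMod p)) : DirichletCharacter (ZMod p) D.natAbs))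
    (hχJ : ∀ a : ℕ, χ (a : ZMod D.natAbs) = J((a : ℤ) | D.natAbs)) (hχp1 : χ (p : ZMod D.natAbs) = 1)
    {m : ℕ} [NeZero m] (φ : DirichletCharacter (ZMod p) m) {d : ℕ} [NeZero d]
    (ψ : DirichletCharacter (ZMod p) d) (hψ : ψ.IsPrimitive) (hdD : d.Coprime D.natAbs)
    (hψq : ψ.IsQuadratic) (hψe : ψ.Even)
    (hφψ : ∀ a : ℕ, ¬ p ∣ a → φ (a : ZMod m) * (a : ZMod p)⁻¹ = ψ⁻¹ (a : ZMod d))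
    (hψp : ψ (p : ZMod d) ≠ 1) (hh : ¬ p ∣ BinaryQuadraticForm.classNumber ((d : ℤ) * D)) :
    ‖characterLValueC p (changeLevel (dvd_mul_right m D.natAbs) φ *
          changeLevel (dvd_mul_left D.natAbs m) (χ.ringHomComp (Int.castRingHom (ZMod p))) :
        DirichletCharacter (ZMod p) (m * D.natAbs)) ∅ 1‖ = 1 ∧
      ‖characterLValueD p (changeLevel (dvd_mul_right d D.natAbs) ψ *
          changeLevel (dvd_mul_left D.natAbs d) (χ.ringHomComp (Int.castRingHom (ZMod p))) :
        DirichletCharacter (ZMod p) (d * D.natAbs)) ∅ 1‖ = 1 := by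
  have hprim := isPrimitive_changeLevel_mul_changeLevel hψ hχp hdD
  have hquad := isQuadratic_twistChar (p := p) ψ χ hψq hχ2
  have hodd := odd_twistChar_of_even (p := p) ψ χ hψe (jacobiChar_neg_one hD4 (by omega) χ hχJ)
  have hd1 : 1 ≤ d := Nat.one_le_iff_ne_zero.mpr (NeZero.ne d)
  have hN5 : 5 ≤ D.natAbs := by omega
  have hd4 : 4 < d * D.natAbs := lt_of_lt_of_le (by norm_num) (Nat.mul_le_mul hd1 hN5)
  have hψ'p : (changeLevel (dvd_mul_right d D.natAbs) ψ *
        changeLevel (dvd_mul_left D.natAbs d) (χ.ringHomComp (Int.castRingHom (ZMod p))) :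
      DirichletCharacter (ZMod p) (d * D.natAbs)) (p : ZMod (d * D.natAbs)) ≠ 1 := by
    rw [twistChar_natCast_of_apply_eq_one ψ χ hχp1]
    exact hψp
  have hneg : -((d * D.natAbs : ℕ) : ℤ) = (d : ℤ) * D := by
    rw [Nat.cast_mul, Int.natCast_natAbs, abs_of_neg (by omega)]
    ring
  have hB := (norm_twistedBernoulli_teichmullerLift_inv_eq_one_iff_of_isPrimitive p hp2 hd4 _ hquad hprim
    hodd).mpr (by rw [hneg]; exact hh)
  exact klFlat_of_norm_twistedBernoulli_eq_one p _ _ hp2 (weil_twistChar φ ψ χ hχ2 hφψ) hψ'p hB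

/-! ## §3. The doors of parts 1–2 with ONE class number in place of the two units -/

/-- **The carrier clause at the twist, FIRST X2b SHAPE, CLASS-NUMBER FORM.** As part 1's
`klFlatCarrier_twist_of_lineRamifiedOdd` (line of `W` ramified-odd, primitive `φ` mod `m ∋ p`, `ψ` mod `d ∌ p`, …), with
the two units of the twisted characters REPLACED by: `ψ` quadratic-valued and EVEN, the Weil relation `φ(a)a⁻¹ = ψ⁻¹(a)`
(`p ∤ a`; GV p. 28 `φψ = ω`), `ψ(p) ≠ 1` (no trivial zero — at a NON-split pair `ψ(p) = a_p = −1`), `d_K < −4`, and ONE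
class number `p ∤ h(d·d_K)` (§2 at `D = d_K`, `χ(p) = 1` because `p` splits in `K`). Conclusion: the `hKL` clause of
p645525 §3 for every globally minimal model of `W^{(d_K)}` — the body of w5's `hDict` (p652304) at this `K`.
[cite: GreenbergVatsal2000, Thm. (1.3), §2 p. 28, §3 (26)–(28)] [cite: Washington1997, Thm. 4.17, Thm. 5.11]
[cite: SilvermanAEC2009, X.5 Cor. 5.4] [cite: Cox2013, Thm. 7.7 (ii)] -/
theorem klFlatCarrier_twist_of_lineRamifiedOdd_of_classNumber
    (W : WeierstrassCurve ℚ) [W.IsElliptic] {p : ℕ} [Fact p.Prime] (hp2 : p ≠ 2)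
    (K : Type) [Field K] [NumberField K] (hK : IsImaginaryQuadratic K) (hodd : Odd (NumberField.discr K))
    [NeZero (NumberField.discr K).natAbs]
    {N₀ : ℕ} (hHN : SatisfiesHeegnerHypothesis N₀ K) (hHp : SatisfiesHeegnerHypothesis p K)
    (χ : MulChar (ZMod (NumberField.discr K).natAbs) ℤ)
    (hχJ : ∀ a : ℕ, χ (a : ZMod (NumberField.discr K).natAbs) = J((a : ℤ) | (NumberField.discr K).natAbs))
    {Φ₀ : AddSubgroup (geomTorsion W (p : ℤ))} (hΦ : IsRationalLine W p Φ₀)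
    (hram : ¬ LineUnramifiedAt W p Φ₀) (hoddL : LineOdd W p Φ₀)
    {m : ℕ} [NeZero m] (φ : DirichletCharacter (ZMod p) m) {d : ℕ} [NeZero d]
    (ψ : DirichletCharacter (ZMod p) d) (hφ : φ.IsPrimitive) (hψ : ψ.IsPrimitive) (hpm : p ∣ m)
    (hpd : ¬ p ∣ d) (hmD : m.Coprime (NumberField.discr K).natAbs)
    (hdD : d.Coprime (NumberField.discr K).natAbs)
    (hφ0 : ∀ (σ : absoluteGaloisGroup ℚ), ∀ P ∈ Φ₀,
      σ • P = (φ ((modNCyclotomicCharacter ℚ m σ : (ZMod m)ˣ) : ZMod m)).val • P)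
    (hψ0 : ∀ (σ : absoluteGaloisGroup ℚ) (P : geomTorsion W (p : ℤ)),
      σ • P - (ψ ((modNCyclotomicCharacter ℚ d σ : (ZMod d)ˣ) : ZMod d)).val • P ∈ Φ₀)
    (S₀ : Finset (HeightOneSpectrum (𝓞 ℚ))) (hS₀p : ∀ v ∈ S₀, ((p : ℕ) : 𝓞 ℚ) ∉ v.asIdeal)
    (hS₀N : ∀ v ∈ S₀, Rat.HeightOneSpectrum.natGenerator v ∣ N₀)
    (hS : ∀ v : HeightOneSpectrum (𝓞 ℚ), v ∉ S₀ → ((p : ℕ) : 𝓞 ℚ) ∉ v.asIdeal → W.HasGoodReductionAt v)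
    (hψq : ψ.IsQuadratic) (hψe : ψ.Even)
    (hφψ : ∀ a : ℕ, ¬ p ∣ a → φ (a : ZMod m) * (a : ZMod p)⁻¹ = ψ⁻¹ (a : ZMod d))
    (hψp : ψ (p : ZMod d) ≠ 1) (hlt : NumberField.discr K < -4)
    (hh : ¬ p ∣ BinaryQuadraticForm.classNumber ((d : ℤ) * NumberField.discr K))
    (n : ℕ) (hbal : n + ∑ v ∈ S₀, delta W p v =
      ∑ v ∈ S₀, ((if φ (Rat.HeightOneSpectrum.natGenerator v : ZMod m) =
            (Rat.HeightOneSpectrum.natGenerator v : ZMod p)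
          then sFactor p (Rat.HeightOneSpectrum.natGenerator v) else 0) +
        (if ψ (Rat.HeightOneSpectrum.natGenerator v : ZMod d) =
            (Rat.HeightOneSpectrum.natGenerator v : ZMod p)
          then sFactor p (Rat.HeightOneSpectrum.natGenerator v) else 0)))
    (Wd : WeierstrassCurve ℚ) [Wd.IsElliptic] [Wd.IsGloballyMinimal]
    (C : VariableChange ℚ) (hC : C • Wd = W.quadraticTwist (NumberField.discr K : ℚ)) :
    ∃ (V' : WeierstrassCurve ℚ) (_ : V'.IsElliptic) (_ : V'.IsGloballyMinimal), IsIsogenous Wd V' ∧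
      ∃ (S₀' : Finset (HeightOneSpectrum (𝓞 ℚ))) (Φ' : AddSubgroup (V'.geomTorsion (p : ℤ)))
        (m' : ℕ) (_ : NeZero m') (φ' : DirichletCharacter (ZMod p) m')
        (d' : ℕ) (_ : NeZero d') (ψ' : DirichletCharacter (ZMod p) d'),
        IsRationalLine V' p Φ' ∧ ¬ LineUnramifiedAt V' p Φ' ∧ LineEven V' p Φ' ∧
        φ'.IsPrimitive ∧ ψ'.IsPrimitive ∧ p ∣ m' ∧ ¬ p ∣ d' ∧
        (∀ (σ : absoluteGaloisGroup ℚ), ∀ Q ∈ Φ',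
          σ • Q = (φ' ((modNCyclotomicCharacter ℚ m' σ : (ZMod m')ˣ) : ZMod m')).val • Q) ∧
        (∀ (σ : absoluteGaloisGroup ℚ) (Q : V'.geomTorsion (p : ℤ)),
          σ • Q - (ψ' ((modNCyclotomicCharacter ℚ d' σ : (ZMod d')ˣ) : ZMod d')).val • Q ∈ Φ') ∧
        (∀ v ∈ S₀', ((p : ℕ) : 𝓞 ℚ) ∉ v.asIdeal) ∧
        (∀ v : HeightOneSpectrum (𝓞 ℚ), v ∉ S₀' → ((p : ℕ) : 𝓞 ℚ) ∉ v.asIdeal →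
          V'.HasGoodReductionAt v) ∧
        ‖characterLValueC p φ' ∅ 1‖ = 1 ∧ ‖characterLValueD p ψ' ∅ 1‖ = 1 ∧
        n + ∑ v ∈ S₀', delta V' p v =
          ∑ v ∈ S₀', ((if φ' (Rat.HeightOneSpectrum.natGenerator v : ZMod m') =
                (Rat.HeightOneSpectrum.natGenerator v : ZMod p)
              then sFactor p (Rat.HeightOneSpectrum.natGenerator v) else 0) +
            (if ψ' (Rat.HeightOneSpectrum.natGenerator v : ZMod d') =
                (Rat.HeightOneSpectrum.natGenerator v : ZMod p)
              then sFactor p (Rat.HeightOneSpectrum.natGenerator v) else 0)) := by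
  have hpP : p.Prime := Fact.out
  have h2 : Module.finrank ℚ K = 2 := hK.1
  obtain ⟨hD4, hsqN⟩ := discr_emod_four_eq_one_and_squarefree_natAbs_of_odd h2 hodd
  -- `χ` IS part 3's Jacobi character (quadratic, `χ̄` primitive); `χ(p) = 1` since `p` splits in `K`
  obtain ⟨χ', hχ2, hχp, hχJ', -⟩ := exists_quadraticChar_geomSqrt_of_emod_four (p := p) hp2 hD4 hsqN
  obtain rfl : χ = χ' := mulChar_eq_of_forall_natCast fun a ↦ by rw [hχJ, hχJ']
  have hχp1 : χ (p : ZMod (NumberField.discr K).natAbs) = 1 :=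
    chi_natCast_eq_one_of_heegner' h2 hD4 hHp χ hχJ hpP dvd_rfl
  obtain ⟨hC1, hD1⟩ := klFlat_twistChar_of_not_dvd_classNumber hp2 hD4 hlt χ hχ2 hχp hχJ hχp1 φ ψ hψ hdD hψq
    hψe hφψ hψp hh
  exact klFlatCarrier_twist_of_lineRamifiedOdd W hp2 K hK hodd hHN hHp χ hχJ hΦ hram hoddL φ ψ hφ hψ hpm hpd hmD
    hdD hφ0 hψ0 S₀ hS₀p hS₀N hS hC1 hD1 n hbal Wd C hC

/-- **The carrier clause at the twist, SECOND X2b SHAPE, CLASS-NUMBER FORM.** As part 2's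
`klFlatCarrier_twist_of_lineUnramifiedEven` (`W` globally minimal, multiplicative at `p`, line UNRAMIFIED-EVEN with
primitive `φ` mod `m ∌ p`, `ψ` mod `d ∋ p`), with the two units REPLACED by: `φ` quadratic-valued and EVEN, the Weil
relation `φ(a)a⁻¹ = ψ⁻¹(a)` (same orientation as p645771; swapped inside by `weil_symm`), `φ(p) ≠ 1` (at a NON-split
pair `φ(p) = a_p = −1`), `d_K < −4`, ONE class number `p ∤ h(m·d_K)` (the carrier `Wd/Ψ₀` has quotient character
`φχ̄`). Conclusion: the `hKL` clause of p645525 §3 for every globally minimal model of `W^{(d_K)}`.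
[cite: GreenbergVatsal2000, Thm. (1.3), §2 p. 28, §3 (26)–(28)] [cite: Washington1997, Thm. 4.17, Thm. 5.11]
[cite: SilvermanATAEC1994, Thm. V.5.3, Cor. V.5.4] [cite: Cox2013, Thm. 7.7 (ii)] -/
theorem klFlatCarrier_twist_of_lineUnramifiedEven_of_classNumber
    (W : WeierstrassCurve ℚ) [W.IsElliptic] [W.IsGloballyMinimal] {p : ℕ} [Fact p.Prime] (hp2 : p ≠ 2)
    (hmult : W.HasMultiplicativeReductionAtPrime p)
    (K : Type) [Field K] [NumberField K] (hK : IsImaginaryQuadratic K) (hodd : Odd (NumberField.discr K))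
    [NeZero (NumberField.discr K).natAbs]
    {N₀ : ℕ} (hHN : SatisfiesHeegnerHypothesis N₀ K) (hHp : SatisfiesHeegnerHypothesis p K)
    (χ : MulChar (ZMod (NumberField.discr K).natAbs) ℤ)
    (hχJ : ∀ a : ℕ, χ (a : ZMod (NumberField.discr K).natAbs) = J((a : ℤ) | (NumberField.discr K).natAbs))
    {Φ₀ : AddSubgroup (geomTorsion W (p : ℤ))} (hΦ : IsRationalLine W p Φ₀)
    (hunr : LineUnramifiedAt W p Φ₀) (hevenL : LineEven W p Φ₀)
    {m : ℕ} [NeZero m] (φ : DirichletCharacter (ZMod p) m) {d : ℕ} [NeZero d]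
    (ψ : DirichletCharacter (ZMod p) d) (hφ : φ.IsPrimitive) (hψ : ψ.IsPrimitive) (hpm : ¬ p ∣ m)
    (hpd : p ∣ d) (hmD : m.Coprime (NumberField.discr K).natAbs)
    (hdD : d.Coprime (NumberField.discr K).natAbs)
    (hφ0 : ∀ (σ : absoluteGaloisGroup ℚ), ∀ P ∈ Φ₀,
      σ • P = (φ ((modNCyclotomicCharacter ℚ m σ : (ZMod m)ˣ) : ZMod m)).val • P)
    (hψ0 : ∀ (σ : absoluteGaloisGroup ℚ) (P : geomTorsion W (p : ℤ)),
      σ • P - (ψ ((modNCyclotomicCharacter ℚ d σ : (ZMod d)ˣ) : ZMod d)).val • P ∈ Φ₀)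
    (S₀ : Finset (HeightOneSpectrum (𝓞 ℚ))) (hS₀p : ∀ v ∈ S₀, ((p : ℕ) : 𝓞 ℚ) ∉ v.asIdeal)
    (hS₀N : ∀ v ∈ S₀, Rat.HeightOneSpectrum.natGenerator v ∣ N₀)
    (hS : ∀ v : HeightOneSpectrum (𝓞 ℚ), v ∉ S₀ → ((p : ℕ) : 𝓞 ℚ) ∉ v.asIdeal → W.HasGoodReductionAt v)
    (hφq : φ.IsQuadratic) (hφe : φ.Even)
    (hφψ : ∀ a : ℕ, ¬ p ∣ a → φ (a : ZMod m) * (a : ZMod p)⁻¹ = ψ⁻¹ (a : ZMod d))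
    (hφp : φ (p : ZMod m) ≠ 1) (hlt : NumberField.discr K < -4)
    (hh : ¬ p ∣ BinaryQuadraticForm.classNumber ((m : ℤ) * NumberField.discr K))
    (n : ℕ) (hbal : n + ∑ v ∈ S₀, delta W p v =
      ∑ v ∈ S₀, ((if φ (Rat.HeightOneSpectrum.natGenerator v : ZMod m) =
            (Rat.HeightOneSpectrum.natGenerator v : ZMod p)
          then sFactor p (Rat.HeightOneSpectrum.natGenerator v) else 0) +
        (if ψ (Rat.HeightOneSpectrum.natGenerator v : ZMod d) =
            (Rat.HeightOneSpectrum.natGenerator v : ZMod p)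
          then sFactor p (Rat.HeightOneSpectrum.natGenerator v) else 0)))
    (Wd : WeierstrassCurve ℚ) [Wd.IsElliptic] [Wd.IsGloballyMinimal]
    (C : VariableChange ℚ) (hC : C • Wd = W.quadraticTwist (NumberField.discr K : ℚ)) :
    ∃ (V' : WeierstrassCurve ℚ) (_ : V'.IsElliptic) (_ : V'.IsGloballyMinimal), IsIsogenous Wd V' ∧
      ∃ (S₀' : Finset (HeightOneSpectrum (𝓞 ℚ))) (Φ' : AddSubgroup (V'.geomTorsion (p : ℤ)))
        (m' : ℕ) (_ : NeZero m') (φ' : DirichletCharacter (ZMod p) m')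
        (d' : ℕ) (_ : NeZero d') (ψ' : DirichletCharacter (ZMod p) d'),
        IsRationalLine V' p Φ' ∧ ¬ LineUnramifiedAt V' p Φ' ∧ LineEven V' p Φ' ∧
        φ'.IsPrimitive ∧ ψ'.IsPrimitive ∧ p ∣ m' ∧ ¬ p ∣ d' ∧
        (∀ (σ : absoluteGaloisGroup ℚ), ∀ Q ∈ Φ',
          σ • Q = (φ' ((modNCyclotomicCharacter ℚ m' σ : (ZMod m')ˣ) : ZMod m')).val • Q) ∧
        (∀ (σ : absoluteGaloisGroup ℚ) (Q : V'.geomTorsion (p : ℤ)),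
          σ • Q - (ψ' ((modNCyclotomicCharacter ℚ d' σ : (ZMod d')ˣ) : ZMod d')).val • Q ∈ Φ') ∧
        (∀ v ∈ S₀', ((p : ℕ) : 𝓞 ℚ) ∉ v.asIdeal) ∧
        (∀ v : HeightOneSpectrum (𝓞 ℚ), v ∉ S₀' → ((p : ℕ) : 𝓞 ℚ) ∉ v.asIdeal →
          V'.HasGoodReductionAt v) ∧
        ‖characterLValueC p φ' ∅ 1‖ = 1 ∧ ‖characterLValueD p ψ' ∅ 1‖ = 1 ∧
        n + ∑ v ∈ S₀', delta V' p v =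
          ∑ v ∈ S₀', ((if φ' (Rat.HeightOneSpectrum.natGenerator v : ZMod m') =
                (Rat.HeightOneSpectrum.natGenerator v : ZMod p)
              then sFactor p (Rat.HeightOneSpectrum.natGenerator v) else 0) +
            (if ψ' (Rat.HeightOneSpectrum.natGenerator v : ZMod d') =
                (Rat.HeightOneSpectrum.natGenerator v : ZMod p)
              then sFactor p (Rat.HeightOneSpectrum.natGenerator v) else 0)) := by
  have hpP : p.Prime := Fact.out
  have h2 : Module.finrank ℚ K = 2 := hK.1
  obtain ⟨hD4, hsqN⟩ := discr_emod_four_eq_one_and_squarefree_natAbs_of_odd h2 hodd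
  obtain ⟨χ', hχ2, hχp, hχJ', -⟩ := exists_quadraticChar_geomSqrt_of_emod_four (p := p) hp2 hD4 hsqN
  obtain rfl : χ = χ' := mulChar_eq_of_forall_natCast fun a ↦ by rw [hχJ, hχJ']
  have hχp1 : χ (p : ZMod (NumberField.discr K).natAbs) = 1 :=
    chi_natCast_eq_one_of_heegner' h2 hD4 hHp χ hχJ hpP dvd_rfl
  -- §2 with the roles of (φ, ψ) swapped: the carrier's quotient character is `φχ̄`
  obtain ⟨hC1, hD1⟩ := klFlat_twistChar_of_not_dvd_classNumber hp2 hD4 hlt χ hχ2 hχp hχJ hχp1 ψ φ hφ hmD hφq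
    hφe (weil_symm φ ψ hφψ) hφp hh
  exact klFlatCarrier_twist_of_lineUnramifiedEven W hp2 hmult K hK hodd hHN hHp χ hχJ hΦ hunr hevenL φ ψ hφ hψ hpm
    hpd hmD hdD hφ0 hψ0 S₀ hS₀p hS₀N hS hC1 hD1 n hbal Wd C hC

end Summit.BirchSwinnertonDyer.BirchSwinnertonDyer.Theorems.EisensteinPrimesMazurMCOnCellBTwistbackTwistDoorClassNumber

end
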